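import Literature.MathematicalPhysics.QuantumFieldTheory.Balaban1983to89.T4TowerRateDischarge
import Summits.QuantumFields.YangMills.Theorems.BalabanUVNodesSpineRates

/-!
# BalabanUVNodes ∕ N19 — the HYPOTHESIS-ONLY BRACKET of `T4OutputRate.u3_threeBrackets` AT THE SPINE CARRIERS: node U3's
# Lipschitz-in-the-background factor (T) `LipBackground ∧ PolyLipGrowth` PRODUCED from printed-shape data by print's own
# NESTED-CONSTANTS device, the two «NOT PRINTED» margin inputs of the tree's Cauchy road DERIVED (cell `pub-ymgap`, HUMAN
# RULING D-0062 Track A, node N19 = NE7, R134 acceleration seat dag-n19-c, strategy s1; count-neutral)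

HONEST FRAMING.  One fixed finite four-torus, rung (B)+1 (existence AND uniqueness of the `ε → 0` limit of Bałaban's
unit-scale averaged loop expectations) — NOT infinite volume, NOT OS on ℝ⁴, NOT a mass gap, NOT the Clay problem.  NE7
(node N19, `Spine.NE7.Core` ∕ `T4MatchingAssembly.HybridNE7`) is NOT PRINTED and NOT proved here; N19 is NOT discharged.
THEOREMS ONLY; 0 `def`; 0 `sorry`; standard axioms.  Nothing of Bałaban's objects is instantiated: the regularity
functional `dev`, the chart `ι`, the complexified term `Ec` and the carriers are PARAMETERS (NODE O ∕ the record predicate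
`RRec` instantiate them).  Filed `--supports` the K3 item `SpineGivenEndpointR11`; NOT a discharge claim.

WHICH BRACKET, BY NAME (dag-lead FAN-OUT v1.1 §N19 s1: «after the by-name knit of `Core` exactly one bracket has no tree
theorem — name it (file:line)»).  `T4OutputRate.u3_threeBrackets` (`Literature/…/T4OutputRate.lean` :227) bounds the
two-run difference `|EA gA UA X − EB gB UB X|` by three brackets times `e^{−κd_j(X)}`: the ARGUMENT bracket
`CU gA (scale X)·δ` (:234, from `hU : LipBackground EA W κ CU` × the closeness `hδ` of NE3), the COUPLING bracket
`Σ_{i<j} Λ j i |gA i − gB i|` (:235, from `h9 : NE9` × node U2's coupling matching) and the FUNCTIONAL bracket `C₅θ^j`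
(:236, from `h5 : NE5`).  After the knits `N19CoreKnit` (p409134) → v5∕v6∕v7 → `N19InEdgesAtRecord` ∕ `N19RateEdgeByName`
(p429658 ∕ p429766) the coupling bracket is N22 × N17 and the functional bracket is N18, DAG-node statements consumed BY
NAME from `RatesAt D R`, and the argument bracket's closeness is N16 BY NAME; the ONE factor that is no node's statement
and is still a RAW component of the link reading at the spine carriers is the argument bracket's Lipschitz factor
**(T) = `LipBackground R.u3.EA R.u3.W R.u3.κ CU ∧ PolyLipGrowth CU g Pg q ∧ 0 ≤ Pg`**
(`Summits/QuantumFields/YangMills/Theorems/BalabanUVNodesN19RateEdgeByName.lean` :203).  At ledger level knit v7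
(`N19MarginByName`, p422044) reads (T) from the tree's Cauchy road `T4TowerRateDischarge.lipBackground_of_analyticMargin`
∕ `polyLipGrowth_of_couplingMargin`, whose two inputs are flagged NOT PRINTED in their own docstrings: `hmargin` — «a
closed `ϱ(g, j)`-ball about EVERY embedded admissible background lies in the analyticity domain» (§1 there: «a quantitative
margin of the real admissible backgrounds inside that space is NOT PRINTED»; `B14.Eq350KernelCauchy` model note (M5):
«that the printed space contains such a polydisc (radius of order α_{0,j}) is [I]'s description of U_j^c, not derived
here») — and `hm` — the margin reading (MR) «`ϱ(g, j) ≥ c₀·g_j`» (§2 there).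

WHAT THIS FILE PROVES — both inputs from PRINTED-SHAPE data by the NESTED-CONSTANTS device of [Balaban1987RG1] p. 263
(«We assume that the constants α₀′, α₁′ are smaller than α₀, α₁ correspondingly … It is obvious that for α₀′ sufficiently
small the above estimates imply the condition (iv), thus the configuration (𝐔, 𝐉) belongs to the space U^c_j(X, α₀, α₁)»;
«In particular the minimal configurations U_j satisfying the bound |∂U_j − 1| < ε₀ξ² with ε₀ sufficiently small, satisfy
the above conditions»; «the action A_k(U) defined on the space U_k(ε₀), which is contained in all the spaces
U^c_j(X, α₀, α₁)»; tree schema `B12Eq117Membership.mem_space_of_shape117`) in its multi-scale dress [Balaban1988Convergent]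
(2.4) p. 255 `ε_j = g_jA₀(log g_j⁻²)^{p₀}` (tree `p0Profile`), (2.28) p. 259 `α_{0,j} = g_jC₀(log g_j⁻²)^{q₀}` (tree
`B14.alphaJ`), (2.34) p. 261 (the layered factor `1 − β(1 − 2^{−(j−n)}) ≥ 1 − β`, tree `B14Radii.shrink`; here the letter
`κ₁`), Theorem 2 p. 263 «for β < 1, and sufficiently regular configurations U_k = U_k(V), e.g. for V restricted by the
characteristic functions in (2.18)» — all entering as HYPOTHESIS SHAPES over the abstract carriers, never as facts:
* §1 `closedBall_subset_sublevel` ∕ `closedBall_halfGap_subset_sublevel` ∕ `creationMargin_of_nestedLevels` — in any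
  seminormed group: if a regularity functional `dev` is one-sided `Λ`-Lipschitz from a point `x` on the relevant ball, `x`
  sits at level `dev x ≤ ε`, and `ε < α`, then the closed ball of radius `(α − ε)∕(2Λ)` about `x` lies in the strict
  sublevel set `{dev < α}` — hence in any analyticity domain CONTAINING that set.  This is v7's `hmargin` (and the b2b
  lineage's creation margin `hcre` of `Support/NE7MarginDisplacementChain.lipBackground_of_transportChain`) DERIVED from:
  «the space is the strict sublevel set of the regularity functionals at radius α» ((1.11)–(1.16) ∕ (2.34)–(2.39) are
  STRICT inequalities) + «the admissible real backgrounds are ε-regular» ((2.18) ∕ [I] (1.2)) + the modulus `Λ`.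
* §2 `mul_p0Profile_eq_alphaJ`, `one_le_log_inv_sq`, `levelGap_ge_mul_coupling` — the LEVEL GAP IN COUPLING UNITS:
  with the outer level `κ₁·α_{0,j}` and the inner level `c·ε_j` of the printed shapes, `p₀ ≤ q₀` (the cell's reconstructed
  exponent restriction (X12), `B14Radii.fits_of_exponents` ∕ `exponent_necessary` — (2.28) prints only «q₀, q₁ integers
  greater than 1») and `cA₀ ≤ κ₁C₀` («C₀ … sufficiently large»), for `0 < g_j`, `g_j² ≤ e⁻¹`:
  `κ₁α_{0,j} − cε_j ≥ (κ₁C₀ − cA₀)·g_j` — so the DERIVED margin `(κ₁α_{0,j} − cε_j)∕(2Λ)` obeys v7's `hm` with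
  `c₀ = (κ₁C₀ − cA₀)∕(2Λ)` (the logarithms only help, as in `T4TowerRateDischarge.alphaJ_ge_mul`).
* §3 `lipBackground_of_nestedLevels` (ONE CALL of `lipBackground_of_analyticMargin` at the derived margin; constant
  `4E₀∕ϱ = 8ΛE₀∕(α − ε)`), `polyLipGrowth_of_nestedLevels` (ONE CALL of `polyLipGrowth_of_couplingMargin`; exponent `1`,
  constant `(4E₀∕c₀)(1∕gIR + √β′)`), **`lipBracket_of_nestedLevels`** — the triple
  `∃ CU Pg, LipBackground EA W κ CU ∧ PolyLipGrowth CU gA Pg 1 ∧ 0 ≤ Pg` over abstract carriers.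
* §4 **`lipBracket_at_u3Carriers`** ∕ `lipBracket_at_rateCarriers` — the same AT node U3's carriers of the K4 split
  (`YMDAG.UVSplit.U3Carriers`, `RateCarriers.u3`): LITERALLY the component (T) of the link reading of
  `N19RateEdgeByName.rateEdge_of_linkReading_byName` (with its `q := 1`), from: (2.27)(ii)+(iv) SHAPE — for every admissible
  coupling sequence `s ∈ u.W` and domain `X`, the scale-`j` term of run A extends to `Ec s X`, complex-differentiable with
  the (1.18) bound `E₀e^{−κd(X)}` on a domain `D s X` CONTAINING the strict sublevel set of `dev s X` at radius
  `κ₁·α_{0,j}(s)`, agreeing with `u.EA s U X` at embedded backgrounds; (2.18) SHAPE — the carrier's run-A backgrounds are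
  `c·ε_j(s)`-regular for `dev s X`; STRUCTURE — `dev s X` is one-sided `Λ`-Lipschitz from embedded backgrounds in the chart
  norm on the margin ball (the companion file shows this is of printed KIND: the plaquette product is locally Lipschitz in
  the bond variables), the chart is dominated by the carrier's gauge; LETTERS — `p₀ ≤ q₀`, `cA₀ < κ₁C₀`, signs, the window's
  smallness `0 < s_j`, `s_j² ≤ e⁻¹`; and, exactly as in v7, run A's cutoff tables `g K ∈ u.W` with the upper running
  `1∕(g K j)² ≤ 1∕gIR² + β′(K − j)` ((2.6) `B14.FlowIneq26` ∕ (0.31), `T4TowerRateDischarge.invSq_le_of_flowIneq26`).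
* COMPANION `BalabanUVNodesN19LipBracketNestedRadiiWitness` (split off under the 400-line rule): (§5 there) the STRUCTURAL
  input is of printed KIND — in any normed ring the plaquette product `U(b₁)U(b₂)U(b₃)U(b₄)` is locally Lipschitz in the bond
  variables, so the plaquette deviation `‖∂z − 1‖` is one-sided `32`-Lipschitz near unitary-size configurations
  (`plaquetteDev_oneSidedLip`); (§6 there) NON-VACUITY of `lipBackground_of_nestedLevels` on the tree's `toyCarriers`
  (`toy_nestedLevels`: chart `ℝ ↪ ℂ`, `dev z = |Im z|`, strip domain, `E₀e^{−α}cos z`).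

WHAT REMAINS HYPOTHESIS after this file (census of (T) at the spine carriers): the (2.27)(ii)+(iv) SHAPE for run A's
terms on Bałaban's carriers of record (NODE O: `D`, `Ec`, the sublevel inclusion at radius `κ₁α_{0,j}`), the (2.18)-level
of the record's backgrounds, the modulus `Λ` of the record's regularity functionals in the record's chart and the
chart–gauge domination (conventions of the instancer), the letters.  NO «quantitative margin» and NO «margin ≥ c₀g_j»
hypothesis is left: both are theorems here.  A v8 of the 113-component link reading with (T) replaced by these inputs is
one `obtain` on `lipBracket_at_rateCarriers` and is deliberately NOT restated (400-line rule; dag-lead's word pending).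

CITATION HEADER (LOCATIONS only, as transcribed in the headers of the imported modules `T4OutputRate`,
`T4TowerRateDischarge`, `B14`, `B14Radii`, `B12Eq117Membership`; no decl below carries a cite tag).  [Balaban1987RG1]
T. Bałaban, CMP **109** (1987) 249–301 — (1.2) p. 260, (1.11)–(1.16) p. 262, (1.17)–(1.18) and the three sentences quoted
above p. 263, (0.31) p. 259.  [Balaban1988Convergent] T. Bałaban, CMP **119** (1988) 243–285 — (2.4), (2.6) p. 255;
(2.18) p. 257; (2.27)(ii)(iv), (2.28) p. 259; (2.34)–(2.39) p. 261; Thm 2 p. 263.  [DimockYuan2024GNFlow] proof of Thm 4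
(the Cauchy device, as cited in `T4TowerRateDischarge`).
-/

open Metric

namespace Summit.QuantumFields.YangMills.BalabanUVNodes.N19LipBracketNestedRadii

open Literature.MathematicalPhysics.QuantumFieldTheory.Balaban1983to89
open T4OutputRate (Carriers Functional LipBackground)
open T4TowerRateComposition (PolyLipGrowth)
open T4TowerRateDischarge (lipBackground_of_analyticMargin polyLipGrowth_of_couplingMargin)

/-! ## §1 Nested levels: a strict sublevel set of a one-sided Lipschitz functional contains a closed ball about every
point of lower level -/

section Sublevel

variable {E : Type*} [SeminormedAddCommGroup E]

/-- **NESTED LEVELS GIVE A BALL.**  If `dev` grows from `x` at most `Λ`-Lipschitz on the closed `ϱ`-ball about `x`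
(`Λ ≥ 0`), `dev x ≤ ε`, and `ε + Λϱ < α`, then the closed `ϱ`-ball about `x` lies in the strict sublevel set `{dev < α}` —
the arithmetic of [Balaban1987RG1] p. 263 «α₀′ < α₀ … the configuration belongs to the space U^c_j(X, α₀, α₁)» with the
real point ALLOWED TO MOVE inside the complex space. [folklore] -/
theorem closedBall_subset_sublevel {dev : E → ℝ} {x : E} {Λ ε α ϱ : ℝ}
    (hLip : ∀ z, ‖z - x‖ ≤ ϱ → dev z ≤ dev x + Λ * ‖z - x‖) (hx : dev x ≤ ε) (hΛ : 0 ≤ Λ)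
    (hϱ : ε + Λ * ϱ < α) : closedBall x ϱ ⊆ {z | dev z < α} := by
  intro z hz
  rw [mem_closedBall_iff_norm] at hz
  show dev z < α
  calc dev z ≤ dev x + Λ * ‖z - x‖ := hLip z hz
    _ ≤ ε + Λ * ϱ := add_le_add hx (mul_le_mul_of_nonneg_left hz hΛ)
    _ < α := hϱ

/-- **THE HALF-GAP RADIUS.**  With `Λ > 0` and `ε < α` the canonical radius `(α − ε)∕(2Λ)` works: the closed ball of that
radius about a point of level `≤ ε` lies in `{dev < α}` (indeed its points have level `≤ (α + ε)∕2`). [folklore] -/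
theorem closedBall_halfGap_subset_sublevel {dev : E → ℝ} {x : E} {Λ ε α : ℝ}
    (hLip : ∀ z, ‖z - x‖ ≤ (α - ε) / (2 * Λ) → dev z ≤ dev x + Λ * ‖z - x‖) (hx : dev x ≤ ε) (hΛ : 0 < Λ)
    (hεα : ε < α) : closedBall x ((α - ε) / (2 * Λ)) ⊆ {z | dev z < α} := by
  refine closedBall_subset_sublevel hLip hx hΛ.le ?_
  have hΛ0 : Λ ≠ 0 := hΛ.ne'
  have h : Λ * ((α - ε) / (2 * Λ)) = (α - ε) / 2 := by
    field_simp
  rw [h]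
  linarith

/-- **THE CREATION MARGIN FROM NESTED LEVELS.**  If a domain `D` CONTAINS the strict sublevel set `{dev < α}` (the
analyticity space IS such a set: (1.11)–(1.16) ∕ (2.34)–(2.39) are strict inequalities on regularity functionals), then
under the hypotheses of `closedBall_halfGap_subset_sublevel` the closed `(α − ε)∕(2Λ)`-ball about `x` lies in `D` — the
shape of `T4TowerRateDischarge.lipBackground_of_analyticMargin`'s `hmargin` and of the b2b lineage's creation margin
`hcre`. [folklore] -/
theorem creationMargin_of_nestedLevels {dev : E → ℝ} {D : Set E} {x : E} {Λ ε α : ℝ}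
    (hspace : {z | dev z < α} ⊆ D)
    (hLip : ∀ z, ‖z - x‖ ≤ (α - ε) / (2 * Λ) → dev z ≤ dev x + Λ * ‖z - x‖) (hx : dev x ≤ ε) (hΛ : 0 < Λ)
    (hεα : ε < α) : closedBall x ((α - ε) / (2 * Λ)) ⊆ D :=
  (closedBall_halfGap_subset_sublevel hLip hx hΛ hεα).trans hspace

end Sublevel

/-! ## §2 The level gap in coupling units: (2.4), (2.28), `p₀ ≤ q₀`, `cA₀ ≤ κ₁C₀` ⇒ `κ₁α_{0,j} − cε_j ≥ (κ₁C₀ − cA₀)·g_j` -/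

section CouplingUnits

/-- The small-field size of (2.4) has the functional shape of (2.28): `g·p₀(g) = g·A₀·(log g⁻²)^{p₀} = alphaJ A₀ p₀ g`
(tree letters `p0Profile`, `B14.alphaJ`). [folklore] -/
theorem mul_p0Profile_eq_alphaJ (A₀ g : ℝ) (p₀ : ℕ) : g * p0Profile A₀ p₀ g = B14.alphaJ A₀ p₀ g := by
  unfold p0Profile B14.alphaJ
  ring

/-- For a small positive coupling, `g² ≤ e⁻¹`, the printed logarithm is at least one: `1 ≤ log g⁻²` (the step of
`T4TowerRateDischarge.alphaJ_ge_mul`, isolated). [folklore] -/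
theorem one_le_log_inv_sq {g : ℝ} (hg : 0 < g) (hsmall : g ^ 2 ≤ Real.exp (-1)) : 1 ≤ Real.log (g ^ 2)⁻¹ := by
  rw [Real.log_inv]
  have hpos : 0 < g ^ 2 := by positivity
  have h := Real.log_le_log hpos hsmall
  rw [Real.log_exp] at h
  linarith

/-- **THE LEVEL GAP IN COUPLING UNITS.**  Outer level `κ₁·α_{0,j}` with the printed radius shape (2.28)
`α_{0,j} = g_jC₀(log g_j⁻²)^{q₀}` (`κ₁` = an overall factor, e.g. the layered coefficient `1 − β(1 − 2^{−m}) ≥ 1 − β` of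
(2.34), or `1`), inner level `c·ε_j` with the printed small-field shape (2.4) `ε_j = g_jA₀(log g_j⁻²)^{p₀}`; exponents
`p₀ ≤ q₀` (the cell's reconstructed (X12) — `B14Radii.exponent_necessary` shows it is forced at small couplings) and
constants `cA₀ ≤ κ₁C₀` («C₀ … sufficiently large»); `0 < g_j`, `g_j² ≤ e⁻¹`.  THEN the gap between the two levels is at
least LINEAR in the coupling: `(κ₁C₀ − cA₀)·g_j ≤ κ₁α_{0,j} − cε_j` — the logarithms only help. [folklore] -/
theorem levelGap_ge_mul_coupling {κ₁ C₀ c A₀ g : ℝ} {p₀ q₀ : ℕ} (hκ₁ : 0 ≤ κ₁) (hC₀ : 0 ≤ C₀)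
    (hC : c * A₀ ≤ κ₁ * C₀) (hpq : p₀ ≤ q₀) (hg : 0 < g) (hsmall : g ^ 2 ≤ Real.exp (-1)) :
    (κ₁ * C₀ - c * A₀) * g ≤ κ₁ * B14.alphaJ C₀ q₀ g - c * (g * p0Profile A₀ p₀ g) := by
  set x := Real.log (g ^ 2)⁻¹ with hx
  have hx1 : 1 ≤ x := one_le_log_inv_sq hg hsmall
  have hxp : 1 ≤ x ^ p₀ := one_le_pow₀ hx1
  have hxpq : x ^ p₀ ≤ x ^ q₀ := pow_le_pow_right₀ hx1 hpq
  have e1 : κ₁ * B14.alphaJ C₀ q₀ g - c * (g * p0Profile A₀ p₀ g) =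
      g * (κ₁ * C₀ * x ^ q₀ - c * A₀ * x ^ p₀) := by
    simp only [B14.alphaJ, p0Profile, hx]
    ring
  rw [e1]
  have h1 : (κ₁ * C₀ - c * A₀) * 1 ≤ (κ₁ * C₀ - c * A₀) * x ^ p₀ :=
    mul_le_mul_of_nonneg_left hxp (sub_nonneg.mpr hC)
  have h2 : κ₁ * C₀ * x ^ p₀ ≤ κ₁ * C₀ * x ^ q₀ := mul_le_mul_of_nonneg_left hxpq (mul_nonneg hκ₁ hC₀)
  calc (κ₁ * C₀ - c * A₀) * g = g * ((κ₁ * C₀ - c * A₀) * 1) := by ring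
    _ ≤ g * ((κ₁ * C₀ - c * A₀) * x ^ p₀) := mul_le_mul_of_nonneg_left h1 hg.le
    _ = g * (κ₁ * C₀ * x ^ p₀ - c * A₀ * x ^ p₀) := by ring
    _ ≤ g * (κ₁ * C₀ * x ^ q₀ - c * A₀ * x ^ p₀) :=
        mul_le_mul_of_nonneg_left (sub_le_sub_right h2 _) hg.le

/-- The strict form: with `cA₀ < κ₁C₀` the inner level is STRICTLY below the outer one, `cε_j < κ₁α_{0,j}`, at every
small positive coupling. [folklore] -/
theorem innerLevel_lt_outerLevel {κ₁ C₀ c A₀ g : ℝ} {p₀ q₀ : ℕ} (hκ₁ : 0 ≤ κ₁) (hC₀ : 0 ≤ C₀)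
    (hC : c * A₀ < κ₁ * C₀) (hpq : p₀ ≤ q₀) (hg : 0 < g) (hsmall : g ^ 2 ≤ Real.exp (-1)) :
    c * (g * p0Profile A₀ p₀ g) < κ₁ * B14.alphaJ C₀ q₀ g := by
  have h := levelGap_ge_mul_coupling (p₀ := p₀) (q₀ := q₀) hκ₁ hC₀ hC.le hpq hg hsmall
  have hpos : 0 < (κ₁ * C₀ - c * A₀) * g := mul_pos (sub_pos.mpr hC) hg
  linarith

end CouplingUnits

/-! ## §3 The bracket (T) over abstract carriers: `LipBackground` and `PolyLipGrowth` from nested levels -/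

section Lip

variable {C : Carriers} {E : Type*} [NormedAddCommGroup E] [NormedSpace ℂ E]

/-- **`LipBackground` FROM NESTED LEVELS** (the Cauchy road with its margin DERIVED).  DATA over the abstract carriers, for
every admissible coupling sequence `g ∈ W` and domain `X` (ALL HYPOTHESIS SHAPES; nothing of Bałaban's is instantiated): a
chart `ι` of run-A backgrounds into a complex normed space, dominated by the carrier's gauge; a regularity functional
`dev g X` on the chart space; an analyticity domain `D g X` CONTAINING the strict sublevel set of `dev g X` at the outer
level `α g (scale X)` ((2.27)(ii) SHAPE: the term is analytic on the space `U^c_j(X, α_{0,j}, α_{1,j})`, itself a strict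
sublevel set); the complexified term `Ec g X`, complex-differentiable on `D g X` with the (1.18) bound `E₀e^{−κd(X)}`
((2.27)(iv) SHAPE) and agreeing with the real values at embedded backgrounds ((I.1.9)); the backgrounds of the carrier at
inner level `dev g X (ι U) ≤ ε g (scale X)` ((2.18) ∕ [I] (1.2) SHAPE: «sufficiently regular configurations»), `ε < α`;
and the STRUCTURAL modulus: `dev g X` one-sided `Λ`-Lipschitz (`Λ > 0`) from each embedded background on the half-gap ball.
CONCLUSION: `LipBackground EA W κ (4E₀∕ϱ)` with the DERIVED margin `ϱ g j = (α g j − ε g j)∕(2Λ)` — ONE CALL of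
`T4TowerRateDischarge.lipBackground_of_analyticMargin`, its `hmargin` discharged by §1. [folklore] -/
theorem lipBackground_of_nestedLevels {EA : Functional C C.BgA} {W : Set (ℕ → ℝ)} {κ E₀ Λ : ℝ}
    (ι : C.BgA → E) (D : (ℕ → ℝ) → C.Dom → Set E) (dev : (ℕ → ℝ) → C.Dom → E → ℝ)
    (α ε : (ℕ → ℝ) → ℕ → ℝ) (Ec : (ℕ → ℝ) → C.Dom → E → ℂ)
    (hspace : ∀ g ∈ W, ∀ X : C.Dom, {z | dev g X z < α g (C.scale X)} ⊆ D g X)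
    (hhol : ∀ g ∈ W, ∀ X : C.Dom, DifferentiableOn ℂ (Ec g X) (D g X))
    (hbd : ∀ g ∈ W, ∀ X : C.Dom, ∀ z ∈ D g X, ‖Ec g X z‖ ≤ E₀ * Real.exp (-(κ * C.d X)))
    (hreal : ∀ g ∈ W, ∀ (X : C.Dom) (U : C.BgA), Ec g X (ι U) = (EA g U X : ℂ))
    (hLip : ∀ g ∈ W, ∀ (X : C.Dom) (U : C.BgA) (z : E),
      ‖z - ι U‖ ≤ (α g (C.scale X) - ε g (C.scale X)) / (2 * Λ) → dev g X z ≤ dev g X (ι U) + Λ * ‖z - ι U‖)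
    (hΛ : 0 < Λ)
    (hlevel : ∀ g ∈ W, ∀ (X : C.Dom) (U : C.BgA), dev g X (ι U) ≤ ε g (C.scale X))
    (hgap : ∀ g ∈ W, ∀ j, ε g j < α g j)
    (hgauge : ∀ U U' : C.BgA, ‖ι U - ι U'‖ ≤ C.gauge U U') :
    LipBackground EA W κ (fun g j => 4 * E₀ / ((α g j - ε g j) / (2 * Λ))) :=
  lipBackground_of_analyticMargin ι D (fun g j => (α g j - ε g j) / (2 * Λ)) Ec
    (fun g hg j => div_pos (sub_pos.mpr (hgap g hg j)) (by positivity)) hhol hbd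
    (fun g hg X U => creationMargin_of_nestedLevels (hspace g hg X) (hLip g hg X U) (hlevel g hg X U) hΛ
      (hgap g hg _))
    hreal hgauge

/-- **`PolyLipGrowth` FROM NESTED LEVELS IN COUPLING UNITS.**  With the outer level `κ₁·alphaJ C₀ q₀ (g j)` ((2.28) shape)
and the inner level `c·(g j · p0Profile A₀ p₀ (g j))` ((2.4) shape), `p₀ ≤ q₀`, `cA₀ < κ₁C₀`, a window of small positive
couplings (`0 < g_j`, `g_j² ≤ e⁻¹`), run A's cutoff tables `gA K ∈ W` and the upper running
`1∕(gA K j)² ≤ 1∕gIR² + β′(K − j)` for `j ≤ K` ((2.6) ∕ (0.31), as in `T4TowerRateDischarge` §2): the Lipschitz family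
`4E₀∕ϱ` of `lipBackground_of_nestedLevels` grows at most LINEARLY in the remaining scales, with the explicit constant
`(4E₀∕c₀)(1∕gIR + √β′)`, `c₀ = (κ₁C₀ − cA₀)∕(2Λ)` — ONE CALL of `T4TowerRateDischarge.polyLipGrowth_of_couplingMargin`, its
margin reading `hm` discharged by §2. [folklore] -/
theorem polyLipGrowth_of_nestedLevels {W : Set (ℕ → ℝ)} {E₀ Λ κ₁ C₀ c A₀ β' gIR : ℝ} {p₀ q₀ : ℕ} {gA : ℕ → ℕ → ℝ}
    (hE₀ : 0 ≤ E₀) (hΛ : 0 < Λ) (hκ₁ : 0 ≤ κ₁) (hC₀ : 0 ≤ C₀) (hC : c * A₀ < κ₁ * C₀) (hpq : p₀ ≤ q₀)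
    (hW : ∀ g ∈ W, ∀ j, 0 < g j ∧ g j ^ 2 ≤ Real.exp (-1))
    (hgA : ∀ K, gA K ∈ W)
    (hup : ∀ K j, j ≤ K → 1 / gA K j ^ 2 ≤ 1 / gIR ^ 2 + β' * ((K : ℝ) - j)) (hgIR : 0 < gIR) (hβ' : 0 ≤ β') :
    PolyLipGrowth
      (fun g j => 4 * E₀ / ((κ₁ * B14.alphaJ C₀ q₀ (g j) - c * (g j * p0Profile A₀ p₀ (g j))) / (2 * Λ)))
      gA (4 * E₀ / ((κ₁ * C₀ - c * A₀) / (2 * Λ)) * (1 / gIR + Real.sqrt β')) 1 :=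
  polyLipGrowth_of_couplingMargin
    (ϱ := fun g j => (κ₁ * B14.alphaJ C₀ q₀ (g j) - c * (g j * p0Profile A₀ p₀ (g j))) / (2 * Λ))
    (fun g hg j => by
      have h := levelGap_ge_mul_coupling (p₀ := p₀) (q₀ := q₀) hκ₁ hC₀ hC.le hpq (hW g hg j).1 (hW g hg j).2
      show (κ₁ * C₀ - c * A₀) / (2 * Λ) * g j ≤
        (κ₁ * B14.alphaJ C₀ q₀ (g j) - c * (g j * p0Profile A₀ p₀ (g j))) / (2 * Λ)
      rw [div_mul_eq_mul_div]
      exact div_le_div_of_nonneg_right h (by positivity))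
    (div_pos (sub_pos.mpr hC) (by positivity)) hE₀ hgA (fun K j _ => (hW _ (hgA K) j).1) hup hgIR hβ'

/-- **THE BRACKET (T) OVER ABSTRACT CARRIERS.**  Under the data of `lipBackground_of_nestedLevels` with the printed-shape
levels `α g j = κ₁·alphaJ C₀ q₀ (g j)`, `ε g j = c·(g j · p0Profile A₀ p₀ (g j))` and the letters of
`polyLipGrowth_of_nestedLevels`: `∃ CU Pg, LipBackground EA W κ CU ∧ PolyLipGrowth CU gA Pg 1 ∧ 0 ≤ Pg` — node U3's
argument-bracket factor in the exact form the N19 edge consumes it (`N19CoreKnit.core_summable_of_spineNodes`'s `hU hG hPg`,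
`T4TowerRateDischarge.uRateUpTo_of_spine`). [folklore] -/
theorem lipBracket_of_nestedLevels {EA : Functional C C.BgA} {W : Set (ℕ → ℝ)}
    {κ E₀ Λ κ₁ C₀ c A₀ β' gIR : ℝ} {p₀ q₀ : ℕ} {gA : ℕ → ℕ → ℝ}
    (ι : C.BgA → E) (D : (ℕ → ℝ) → C.Dom → Set E) (dev : (ℕ → ℝ) → C.Dom → E → ℝ)
    (Ec : (ℕ → ℝ) → C.Dom → E → ℂ)
    -- (2.27)(ii)+(iv) SHAPE at the outer level κ₁·α_{0,j}
    (hspace : ∀ g ∈ W, ∀ X : C.Dom, {z | dev g X z < κ₁ * B14.alphaJ C₀ q₀ (g (C.scale X))} ⊆ D g X)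
    (hhol : ∀ g ∈ W, ∀ X : C.Dom, DifferentiableOn ℂ (Ec g X) (D g X))
    (hbd : ∀ g ∈ W, ∀ X : C.Dom, ∀ z ∈ D g X, ‖Ec g X z‖ ≤ E₀ * Real.exp (-(κ * C.d X)))
    (hreal : ∀ g ∈ W, ∀ (X : C.Dom) (U : C.BgA), Ec g X (ι U) = (EA g U X : ℂ))
    -- STRUCTURE: the modulus of the regularity functional on the half-gap ball, the chart dominated by the gauge
    (hLip : ∀ g ∈ W, ∀ (X : C.Dom) (U : C.BgA) (z : E),
      ‖z - ι U‖ ≤ (κ₁ * B14.alphaJ C₀ q₀ (g (C.scale X))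
          - c * (g (C.scale X) * p0Profile A₀ p₀ (g (C.scale X)))) / (2 * Λ) →
        dev g X z ≤ dev g X (ι U) + Λ * ‖z - ι U‖)
    (hΛ : 0 < Λ) (hgauge : ∀ U U' : C.BgA, ‖ι U - ι U'‖ ≤ C.gauge U U')
    -- (2.18) SHAPE at the inner level c·ε_j
    (hlevel : ∀ g ∈ W, ∀ (X : C.Dom) (U : C.BgA),
      dev g X (ι U) ≤ c * (g (C.scale X) * p0Profile A₀ p₀ (g (C.scale X))))
    -- LETTERS
    (hE₀ : 0 ≤ E₀) (hκ₁ : 0 ≤ κ₁) (hC₀ : 0 ≤ C₀) (hC : c * A₀ < κ₁ * C₀) (hpq : p₀ ≤ q₀)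
    (hW : ∀ g ∈ W, ∀ j, 0 < g j ∧ g j ^ 2 ≤ Real.exp (-1))
    -- run A's cutoff tables and the upper running of the couplings, as in knit v7
    (hgA : ∀ K, gA K ∈ W)
    (hup : ∀ K j, j ≤ K → 1 / gA K j ^ 2 ≤ 1 / gIR ^ 2 + β' * ((K : ℝ) - j)) (hgIR : 0 < gIR) (hβ' : 0 ≤ β') :
    ∃ (CU : (ℕ → ℝ) → ℕ → ℝ) (Pg : ℝ), LipBackground EA W κ CU ∧ PolyLipGrowth CU gA Pg 1 ∧ 0 ≤ Pg := by
  have hc₀ : 0 < (κ₁ * C₀ - c * A₀) / (2 * Λ) := div_pos (sub_pos.mpr hC) (by positivity)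
  refine ⟨_, _, lipBackground_of_nestedLevels ι D dev (fun g j => κ₁ * B14.alphaJ C₀ q₀ (g j))
    (fun g j => c * (g j * p0Profile A₀ p₀ (g j))) Ec hspace hhol hbd hreal hLip hΛ hlevel
    (fun g hg j => innerLevel_lt_outerLevel hκ₁ hC₀ hC hpq (hW g hg j).1 (hW g hg j).2) hgauge,
    polyLipGrowth_of_nestedLevels hE₀ hΛ hκ₁ hC₀ hC hpq hW hgA hup hgIR hβ', ?_⟩
  exact mul_nonneg (div_nonneg (by positivity) hc₀.le) (by positivity)

end Lip

/-! ## §4 AT THE SPINE CARRIERS: the component (T) of the N19′ link reading at node U3's carriers `YMDAG.UVSplit.U3Carriers` -/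

section AtCarriers

open YMDAG.UVSplit (U3Carriers RateCarriers)

/-- **THE HYPOTHESIS-ONLY BRACKET AT NODE U3's CARRIERS.**  For the U3 sub-bundle `u` of the K4 rate carriers (output
carriers `u.C`, window `u.W`, decay `u.κ`, run A's functional `u.EA` — SHARED by N18 ∕ N22 ∕ N17 ∕ (D4)) and run A's cutoff
tables `g` of the N19′ link reading: from the (2.27)(ii)+(iv) SHAPE of run A's scale-`j` terms in a chart of `u.C.BgA`
(domain containing the regularity space of radius `κ₁α_{0,j}(s)`, (1.18) bound with `u.κ`, real agreement with `u.EA`),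
the (2.18) SHAPE of the carrier's backgrounds (level `≤ cε_j(s)`), the structural modulus `Λ` and chart–gauge domination,
the letters `p₀ ≤ q₀`, `cA₀ < κ₁C₀`, the window's smallness, and the tables' membership + upper running ((2.6)∕(0.31)) —
**`∃ CU Pg, LipBackground u.EA u.W u.κ CU ∧ PolyLipGrowth CU g Pg 1 ∧ 0 ≤ Pg`**, LITERALLY the component (T)
`LipBackground R.u3.EA R.u3.W R.u3.κ CU ∧ PolyLipGrowth CU g Pg q ∧ 0 ≤ Pg` (with `q := 1`) of the link reading of
`N19RateEdgeByName.rateEdge_of_linkReading_byName`.  CONDITIONAL on every binder; nothing of Bałaban's instantiated; NOT NE7;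
N19 NOT discharged. [folklore] -/
theorem lipBracket_at_u3Carriers (u : U3Carriers) {E : Type*} [NormedAddCommGroup E] [NormedSpace ℂ E]
    {E₀ Λ κ₁ C₀ c A₀ β' gIR : ℝ} {p₀ q₀ : ℕ} {g : ℕ → ℕ → ℝ}
    (ι : u.C.BgA → E) (D : (ℕ → ℝ) → u.C.Dom → Set E) (dev : (ℕ → ℝ) → u.C.Dom → E → ℝ)
    (Ec : (ℕ → ℝ) → u.C.Dom → E → ℂ)
    (hspace : ∀ s ∈ u.W, ∀ X : u.C.Dom, {z | dev s X z < κ₁ * B14.alphaJ C₀ q₀ (s (u.C.scale X))} ⊆ D s X)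
    (hhol : ∀ s ∈ u.W, ∀ X : u.C.Dom, DifferentiableOn ℂ (Ec s X) (D s X))
    (hbd : ∀ s ∈ u.W, ∀ X : u.C.Dom, ∀ z ∈ D s X, ‖Ec s X z‖ ≤ E₀ * Real.exp (-(u.κ * u.C.d X)))
    (hreal : ∀ s ∈ u.W, ∀ (X : u.C.Dom) (U : u.C.BgA), Ec s X (ι U) = (u.EA s U X : ℂ))
    (hLip : ∀ s ∈ u.W, ∀ (X : u.C.Dom) (U : u.C.BgA) (z : E),
      ‖z - ι U‖ ≤ (κ₁ * B14.alphaJ C₀ q₀ (s (u.C.scale X))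
          - c * (s (u.C.scale X) * p0Profile A₀ p₀ (s (u.C.scale X)))) / (2 * Λ) →
        dev s X z ≤ dev s X (ι U) + Λ * ‖z - ι U‖)
    (hΛ : 0 < Λ) (hgauge : ∀ U U' : u.C.BgA, ‖ι U - ι U'‖ ≤ u.C.gauge U U')
    (hlevel : ∀ s ∈ u.W, ∀ (X : u.C.Dom) (U : u.C.BgA),
      dev s X (ι U) ≤ c * (s (u.C.scale X) * p0Profile A₀ p₀ (s (u.C.scale X))))
    (hE₀ : 0 ≤ E₀) (hκ₁ : 0 ≤ κ₁) (hC₀ : 0 ≤ C₀) (hC : c * A₀ < κ₁ * C₀) (hpq : p₀ ≤ q₀)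
    (hW : ∀ s ∈ u.W, ∀ j, 0 < s j ∧ s j ^ 2 ≤ Real.exp (-1))
    (hgA : ∀ K, g K ∈ u.W)
    (hup : ∀ K j, j ≤ K → 1 / g K j ^ 2 ≤ 1 / gIR ^ 2 + β' * ((K : ℝ) - j)) (hgIR : 0 < gIR) (hβ' : 0 ≤ β') :
    ∃ (CU : (ℕ → ℝ) → ℕ → ℝ) (Pg : ℝ), LipBackground u.EA u.W u.κ CU ∧ PolyLipGrowth CU g Pg 1 ∧ 0 ≤ Pg :=
  lipBracket_of_nestedLevels ι D dev Ec hspace hhol hbd hreal hLip hΛ hgauge hlevel hE₀ hκ₁ hC₀ hC hpq hW hgA hup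
    hgIR hβ'

/-- The same at the RATE-CARRIER BUNDLE `R : RateCarriers N` of the K4 split, read at its U3 sub-bundle `R.u3` — the
letters of `N19RateEdgeByName.rateEdge_of_linkReading_byName`'s clause verbatim (`R.u3.EA`, `R.u3.W`, `R.u3.κ`).
[folklore] -/
theorem lipBracket_at_rateCarriers {N : ℕ} (R : RateCarriers N) {E : Type*} [NormedAddCommGroup E] [NormedSpace ℂ E]
    {E₀ Λ κ₁ C₀ c A₀ β' gIR : ℝ} {p₀ q₀ : ℕ} {g : ℕ → ℕ → ℝ}
    (ι : R.u3.C.BgA → E) (D : (ℕ → ℝ) → R.u3.C.Dom → Set E) (dev : (ℕ → ℝ) → R.u3.C.Dom → E → ℝ)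
    (Ec : (ℕ → ℝ) → R.u3.C.Dom → E → ℂ)
    (hspace : ∀ s ∈ R.u3.W, ∀ X : R.u3.C.Dom,
      {z | dev s X z < κ₁ * B14.alphaJ C₀ q₀ (s (R.u3.C.scale X))} ⊆ D s X)
    (hhol : ∀ s ∈ R.u3.W, ∀ X : R.u3.C.Dom, DifferentiableOn ℂ (Ec s X) (D s X))
    (hbd : ∀ s ∈ R.u3.W, ∀ X : R.u3.C.Dom, ∀ z ∈ D s X, ‖Ec s X z‖ ≤ E₀ * Real.exp (-(R.u3.κ * R.u3.C.d X)))
    (hreal : ∀ s ∈ R.u3.W, ∀ (X : R.u3.C.Dom) (U : R.u3.C.BgA), Ec s X (ι U) = (R.u3.EA s U X : ℂ))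
    (hLip : ∀ s ∈ R.u3.W, ∀ (X : R.u3.C.Dom) (U : R.u3.C.BgA) (z : E),
      ‖z - ι U‖ ≤ (κ₁ * B14.alphaJ C₀ q₀ (s (R.u3.C.scale X))
          - c * (s (R.u3.C.scale X) * p0Profile A₀ p₀ (s (R.u3.C.scale X)))) / (2 * Λ) →
        dev s X z ≤ dev s X (ι U) + Λ * ‖z - ι U‖)
    (hΛ : 0 < Λ) (hgauge : ∀ U U' : R.u3.C.BgA, ‖ι U - ι U'‖ ≤ R.u3.C.gauge U U')
    (hlevel : ∀ s ∈ R.u3.W, ∀ (X : R.u3.C.Dom) (U : R.u3.C.BgA),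
      dev s X (ι U) ≤ c * (s (R.u3.C.scale X) * p0Profile A₀ p₀ (s (R.u3.C.scale X))))
    (hE₀ : 0 ≤ E₀) (hκ₁ : 0 ≤ κ₁) (hC₀ : 0 ≤ C₀) (hC : c * A₀ < κ₁ * C₀) (hpq : p₀ ≤ q₀)
    (hW : ∀ s ∈ R.u3.W, ∀ j, 0 < s j ∧ s j ^ 2 ≤ Real.exp (-1))
    (hgA : ∀ K, g K ∈ R.u3.W)
    (hup : ∀ K j, j ≤ K → 1 / g K j ^ 2 ≤ 1 / gIR ^ 2 + β' * ((K : ℝ) - j)) (hgIR : 0 < gIR) (hβ' : 0 ≤ β') :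
    ∃ (CU : (ℕ → ℝ) → ℕ → ℝ) (Pg : ℝ),
      LipBackground R.u3.EA R.u3.W R.u3.κ CU ∧ PolyLipGrowth CU g Pg 1 ∧ 0 ≤ Pg :=
  lipBracket_at_u3Carriers R.u3 ι D dev Ec hspace hhol hbd hreal hLip hΛ hgauge hlevel hE₀ hκ₁ hC₀ hC hpq hW hgA hup
    hgIR hβ'

end AtCarriers

end Summit.QuantumFields.YangMills.BalabanUVNodes.N19LipBracketNestedRadii
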